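import Literature.NumberTheory.LFunctions.XiHigherDerivativesCriticalStrip
import Literature.NumberTheory.LFunctions.XiTaylor
import Mathlib.Analysis.InnerProductSpace.Calculus
import Mathlib.Analysis.Complex.RealDeriv
import HarnessLib

/-!
# Horizontal monotonicity of `|ξ^{(m)}(σ + it)|` for every `m` (Sondow–Dumitrescu 2010 for the derivatives of `ξ`)

RH-FREE (one section consists of implications `RiemannHypothesis → …`; nothing is assumed). Nothing
here bears on the truth of RH. Topic `Literature/NumberTheory/LFunctions`.

J. Sondow, C. Dumitrescu, Period. Math. Hungar. 60 (2010) 37–40 (key `SondowDumitrescu2010`) prove for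
`ξ`: **Theorem 1** "the xi function is increasing in modulus along every horizontal half-line lying in any
open right half-plane that contains no xi zeros … for example |ξ(σ + it)| is increasing for 1 < σ < ∞",
and **Corollary 1** "(i) |ξ(σ + it)| is increasing for ½ < σ < ∞ [for every t] ⟺ (iii) the Riemann
Hypothesis" (tree: `XiModulusMonotone.lean`). Their argument is `∂_σ log|f(σ + it)| = Re f′/f(σ + it)`
plus the sign of `Re f′/f` read off the zeros. With Conrey's Lemma 2 for every `m`
(`XiHigherDerivativesCriticalStrip.lean`: `Re ξ^{(m+1)}/ξ^{(m)}(s) > 0` for `Re s ≥ 1`, and for `Re s > ½`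
as soon as the zeros of `ξ^{(m)}` are on the line) the same argument gives, FOR EVERY DERIVATIVE `ξ^{(m)}`:

* **`norm_iteratedDeriv_riemannXi_strictMonoOn_Ici_one`** — unconditionally, for every `m` and real `t`,
  `σ ↦ |ξ^{(m)}(σ + it)|` is strictly increasing on `[1, ∞)` (and strictly decreasing on `(−∞, 0]`,
  `norm_iteratedDeriv_riemannXi_strictAntiOn_Iic_zero`, by `|ξ^{(m)}((1−σ) + it)| = |ξ^{(m)}(σ + it)|`).
* **`iteratedDeriv_riemannXi_zeros_on_line_iff_norm_strictMonoOn`** — the Corollary-1 analogue for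
  `ξ^{(m)}` (RH-free equivalence): all zeros of `ξ^{(m)}` lie on `Re s = ½` **iff** for every real `t`,
  `σ ↦ |ξ^{(m)}(σ + it)|` is strictly increasing on `[½, ∞)`. For `m = 1`
  (`deriv_riemannXi_zeros_on_line_iff_norm_deriv_strictMonoOn`) this is the equivalence "every zero of
  `ξ′` on the critical line ⟺ horizontal monotone modulus of `ξ′` on the right half of the strip".
* RH-CONDITIONAL: **`riemannHypothesis_imp_norm_iteratedDeriv_riemannXi_strictMonoOn`** — RH ⇒ for every
  `m`, `t`: `σ ↦ |ξ^{(m)}(σ + it)|` strictly increasing on `[½, ∞)`.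
* Heredity (Jensen's theorem with `Δ = 0`, tree `abs_im_le_of_iteratedDeriv_eq_zero`, Ki–Kim 2000 Remark
  2.2 (b)): **`iteratedDeriv_riemannXi_zeros_on_line_of_le`** — zeros of `ξ^{(m)}` on the line ⇒ zeros of
  every `ξ^{(m')}`, `m' ≥ m`, on the line (`m = 1`: `…_of_deriv`); hence the monotone modulus is hereditary
  (`norm_iteratedDeriv_riemannXi_strictMonoOn_of_le`).
* `riemannHypothesis_iff_forall_iteratedDeriv_riemannXi_zeros_on_line`,
  `riemannHypothesis_iff_forall_norm_iteratedDeriv_riemannXi_strictMonoOn` — RH ⟺ (every `m`) ⟺ (every `m`, `t`).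

Calculus as in `XiModulusMonotone.lean` (`HasDerivAt.norm_sq`, `strictMonoOn_of_deriv_pos`); the sign
input is `re_iteratedDeriv_succ_div_pos_of_one_le_re` / `XiDerivStrip.re_iteratedDeriv_succ_div_pos`.
AI-produced formalisation (literature-prover-rh-lit-frontier-1-g12-0, 2026-08-27); AI review is weaker
than expert review.

## References

* J. Sondow, C. Dumitrescu, Period. Math. Hungar. 60 (2010) 37–40, Thm 1, Cor 1. [key `SondowDumitrescu2010`]
* J. B. Conrey, J. Number Theory 16 (1983) 49–74, Lemma 2 (p. 52). [key `Conrey1983`]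
* H. Ki, Y.-O. Kim, Duke Math. J. 104 (2000) 45–73, §2, Remark 2.2 (b). [key `KiKim2000`]
-/

noncomputable section

open Complex Filter Set Topology
open scoped ComplexConjugate

namespace Literature.NumberTheory.LFunctions

open Literature.Analysis.Complex

namespace XiDerivMonotone

/-! ## Calculus on a horizontal line -/

/-- The restriction of `ξ^{(m)}` to the horizontal line `Im s = t` is real-differentiable, with derivative
`ξ^{(m+1)}(σ + it)`. [cite: SondowDumitrescu2010, proof of Thm 1] -/
theorem hasDerivAt_horizontal (m : ℕ) (σ t : ℝ) :
    HasDerivAt (fun x : ℝ ↦ iteratedDeriv m riemannXi ((x : ℂ) + t * I))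
      (iteratedDeriv (m + 1) riemannXi ((σ : ℂ) + t * I)) σ := by
  have hd : Differentiable ℂ (iteratedDeriv m riemannXi) :=
    differentiable_iteratedDeriv_of_entire differentiable_riemannXi m
  have h1 : HasDerivAt (fun z : ℂ ↦ iteratedDeriv m riemannXi (z + t * I))
      (iteratedDeriv (m + 1) riemannXi ((σ : ℂ) + t * I)) (σ : ℂ) := by
    have hd' := (hd ((σ : ℂ) + t * I)).hasDerivAt
    rw [← iteratedDeriv_succ] at hd'
    have h2 : HasDerivAt (fun z : ℂ ↦ z + t * I) 1 (σ : ℂ) := (hasDerivAt_id (σ : ℂ)).add_const _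
    have h3 := hd'.comp (σ : ℂ) h2
    simp only [mul_one, Function.comp_def] at h3
    exact h3
  exact h1.comp_ofReal

/-- `d/dσ |ξ^{(m)}(σ + it)|² = 2 Re(conj ξ^{(m)}(σ + it) · ξ^{(m+1)}(σ + it))`.
[cite: SondowDumitrescu2010, proof of Thm 1] -/
theorem hasDerivAt_norm_sq_horizontal (m : ℕ) (σ t : ℝ) :
    HasDerivAt (fun x : ℝ ↦ ‖iteratedDeriv m riemannXi ((x : ℂ) + t * I)‖ ^ 2)
      (2 * (conj (iteratedDeriv m riemannXi ((σ : ℂ) + t * I)) *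
        iteratedDeriv (m + 1) riemannXi ((σ : ℂ) + t * I)).re) σ := by
  have h := (hasDerivAt_horizontal m σ t).norm_sq
  rw [Complex.inner, mul_comm (iteratedDeriv (m + 1) riemannXi _)] at h
  exact h

/-- Where `Re ξ^{(m+1)}/ξ^{(m)} > 0`, the `σ`-derivative of `|ξ^{(m)}|²` is positive:
`Re(conj f · f′) = |f|² · Re(f′/f)`. [cite: SondowDumitrescu2010, proof of Thm 1] -/
theorem re_conj_mul_pos {m : ℕ} {s : ℂ}
    (h : 0 < (iteratedDeriv (m + 1) riemannXi s / iteratedDeriv m riemannXi s).re) :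
    0 < (conj (iteratedDeriv m riemannXi s) * iteratedDeriv (m + 1) riemannXi s).re := by
  have hne : iteratedDeriv m riemannXi s ≠ 0 := by
    intro h0
    simp [h0] at h
  have key : conj (iteratedDeriv m riemannXi s) * iteratedDeriv (m + 1) riemannXi s
      = ((Complex.normSq (iteratedDeriv m riemannXi s) : ℝ) : ℂ) *
        (iteratedDeriv (m + 1) riemannXi s / iteratedDeriv m riemannXi s) := by
    rw [Complex.normSq_eq_conj_mul_self]
    field_simp
  rw [key, Complex.re_ofReal_mul]
  exact mul_pos (Complex.normSq_pos.2 hne) h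

/-- From `Re ξ^{(m+1)}/ξ^{(m)} > 0` at the interior points of a convex set `D` of abscissae to strict
increase of `σ ↦ |ξ^{(m)}(σ + it)|` on `D` (mean value theorem for `|ξ^{(m)}|²`).
[cite: SondowDumitrescu2010, proof of Thm 1] -/
theorem norm_strictMonoOn_of_pos (m : ℕ) {D : Set ℝ} (hD : Convex ℝ D) (t : ℝ)
    (hpos : ∀ σ ∈ interior D, 0 < (iteratedDeriv (m + 1) riemannXi ((σ : ℂ) + t * I) /
      iteratedDeriv m riemannXi ((σ : ℂ) + t * I)).re) :
    StrictMonoOn (fun σ : ℝ ↦ ‖iteratedDeriv m riemannXi ((σ : ℂ) + t * I)‖) D := by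
  have hsq : StrictMonoOn (fun σ : ℝ ↦ ‖iteratedDeriv m riemannXi ((σ : ℂ) + t * I)‖ ^ 2) D := by
    refine strictMonoOn_of_deriv_pos hD ?_ ?_
    · have hc : Continuous fun σ : ℝ ↦ iteratedDeriv m riemannXi ((σ : ℂ) + t * I) :=
        (differentiable_iteratedDeriv_of_entire differentiable_riemannXi m).continuous.comp
          (by fun_prop)
      exact ((continuous_norm.comp hc).pow 2).continuousOn
    · intro x hx
      rw [(hasDerivAt_norm_sq_horizontal m x t).deriv]
      exact mul_pos two_pos (re_conj_mul_pos (hpos x hx))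
  intro a ha b hb hab
  exact lt_of_pow_lt_pow_left₀ 2 (norm_nonneg _) (hsq ha hb hab)

/-- `ξ^{(m)}(1 − s) = (−1)^m ξ^{(m)}(s)`. [cite: Conrey1983, Lemma 2 proof (p. 52)] -/
theorem iteratedDeriv_riemannXi_one_sub (m : ℕ) (s : ℂ) :
    iteratedDeriv m riemannXi (1 - s) = (-1) ^ m * iteratedDeriv m riemannXi s := by
  have hfun : (fun z ↦ riemannXi (1 - z)) = riemannXi := funext riemannXi_one_sub
  have h := congrFun (iteratedDeriv_comp_const_sub (n := m) (f := riemannXi) (s := 1)) s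
  rw [hfun, smul_eq_mul] at h
  have h1 : ((-1 : ℂ) ^ m) * ((-1) ^ m) = 1 := by
    rw [← mul_pow, neg_one_mul, neg_neg, one_pow]
  calc iteratedDeriv m riemannXi (1 - s)
      = ((-1 : ℂ) ^ m * (-1) ^ m) * iteratedDeriv m riemannXi (1 - s) := by rw [h1, one_mul]
    _ = (-1) ^ m * iteratedDeriv m riemannXi s := by rw [h]; ring

/-- `|ξ^{(m)}((1 − σ) + it)| = |ξ^{(m)}(σ + it)|` (functional equation and Schwarz reflection).
[cite: SondowDumitrescu2010, proof of Cor 1] -/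
theorem norm_iteratedDeriv_one_sub_re (m : ℕ) (σ t : ℝ) :
    ‖iteratedDeriv m riemannXi (((1 - σ : ℝ) : ℂ) + t * I)‖ =
      ‖iteratedDeriv m riemannXi ((σ : ℂ) + t * I)‖ := by
  have h : (((1 - σ : ℝ) : ℂ) + t * I) = 1 - conj ((σ : ℂ) + t * I) := by
    apply Complex.ext
    · simp
    · simp
  rw [h, iteratedDeriv_riemannXi_one_sub, iteratedDeriv_conj_of_conj riemannXi_conj_holds,
    norm_mul, norm_pow, norm_neg, norm_one, one_pow, one_mul, Complex.norm_conj]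

end XiDerivMonotone

open XiDerivMonotone

/-! ## Unconditional: `|ξ^{(m)}(σ + it)|` increases on `σ ≥ 1` and decreases on `σ ≤ 0` -/

/-- **Sondow–Dumitrescu's example for every derivative: for every `m` and real `t`,
`σ ↦ |ξ^{(m)}(σ + it)|` is strictly increasing on `[1, ∞)`** (Conrey: `Re ξ^{(m+1)}/ξ^{(m)} > 0` for
`Re s ≥ 1`). [cite: SondowDumitrescu2010, Thm 1] [cite: Conrey1983, Lemma 2 proof (p. 52)] -/
theorem norm_iteratedDeriv_riemannXi_strictMonoOn_Ici_one (m : ℕ) (t : ℝ) :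
    StrictMonoOn (fun σ : ℝ ↦ ‖iteratedDeriv m riemannXi ((σ : ℂ) + t * I)‖) (Ici 1) :=
  norm_strictMonoOn_of_pos m (convex_Ici 1) t fun σ hσ ↦ by
    rw [interior_Ici] at hσ
    exact re_iteratedDeriv_succ_div_pos_of_one_le_re m (by simp; exact le_of_lt hσ)

/-- For every `m` and real `t`, `σ ↦ |ξ^{(m)}(σ + it)|` is strictly decreasing on `(−∞, 0]`.
[cite: SondowDumitrescu2010, Thm 1] [cite: Conrey1983, Lemma 2 proof (p. 52)] -/
theorem norm_iteratedDeriv_riemannXi_strictAntiOn_Iic_zero (m : ℕ) (t : ℝ) :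
    StrictAntiOn (fun σ : ℝ ↦ ‖iteratedDeriv m riemannXi ((σ : ℂ) + t * I)‖) (Iic 0) := by
  intro a ha b hb hab
  have h := norm_iteratedDeriv_riemannXi_strictMonoOn_Ici_one m t
    (show (1 - b : ℝ) ∈ Ici 1 by simp only [mem_Ici, mem_Iic] at hb ⊢; linarith)
    (show (1 - a : ℝ) ∈ Ici 1 by simp only [mem_Ici, mem_Iic] at ha ⊢; linarith)
    (by linarith)
  simp only at h
  rwa [norm_iteratedDeriv_one_sub_re, norm_iteratedDeriv_one_sub_re] at h

/-! ## The Corollary-1 analogue for `ξ^{(m)}` (RH-free equivalence) -/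

/-- **All zeros of `ξ^{(m)}` lie on `Re s = ½` iff `σ ↦ |ξ^{(m)}(σ + it)|` is strictly increasing on
`[½, ∞)` for every real `t`** (Sondow–Dumitrescu's Corollary 1, run for `ξ^{(m)}`: "⇒" by the sign of
`Re ξ^{(m+1)}/ξ^{(m)}` when the zeros of `Ξ^{(m)}` are real; "⇐": "if `|f|` is increasing along a
half-line `L`, `f` cannot have a zero on `L`", and `|ξ^{(m)}((1−σ)+it)| = |ξ^{(m)}(σ+it)|` for the left
half). [cite: SondowDumitrescu2010, Cor 1 and its proof] [cite: Conrey1983, §1 (p. 49)] -/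
theorem iteratedDeriv_riemannXi_zeros_on_line_iff_norm_strictMonoOn (m : ℕ) :
    (∀ s : ℂ, iteratedDeriv m riemannXi s = 0 → s.re = 1 / 2) ↔
      ∀ t : ℝ, StrictMonoOn (fun σ : ℝ ↦ ‖iteratedDeriv m riemannXi ((σ : ℂ) + t * I)‖)
        (Ici (1 / 2)) := by
  constructor
  · intro hline t
    refine norm_strictMonoOn_of_pos m (convex_Ici _) t fun σ hσ ↦ ?_
    rw [interior_Ici, mem_Ioi] at hσ
    refine XiDerivStrip.re_iteratedDeriv_succ_div_pos m (by simpa using hσ) fun a ha ↦ ?_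
    have hz : iteratedDeriv m riemannXi (1 / 2 + I * a) = 0 := by
      have := iteratedDeriv_riemannXiUpper m a
      rw [ha] at this
      exact ((mul_eq_zero.1 this.symm).resolve_left (pow_ne_zero _ I_ne_zero))
    have hre := hline _ hz
    have : a.im = 0 := by
      have e : ((1 : ℂ) / 2 + I * a).re = 1 / 2 - a.im := by simp; ring
      rw [e] at hre
      linarith
    rw [this, abs_zero]
    simpa using hσ
  · intro hmono s hs
    by_contra hne
    -- a zero off the line, moved to the right half by the functional equation if necessary
    have key : ∀ ρ : ℂ, iteratedDeriv m riemannXi ρ = 0 → ¬ (1 / 2 < ρ.re) := by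
      intro ρ hρ hlt
      have h := hmono ρ.im (show (1 / 2 : ℝ) ∈ Ici (1 / 2 : ℝ) from mem_Ici.2 le_rfl)
        (show ρ.re ∈ Ici (1 / 2 : ℝ) from mem_Ici.2 hlt.le) hlt
      have hρeq : ((ρ.re : ℂ) + ρ.im * I) = ρ := by apply Complex.ext <;> simp
      simp only [hρeq, hρ, norm_zero] at h
      exact (norm_nonneg _).not_gt h
    rcases lt_or_gt_of_ne hne with hlt | hgt
    · -- `Re s < ½`: use `1 - conj s`, which has real part `1 - Re s > ½`
      have hzero : iteratedDeriv m riemannXi (1 - conj s) = 0 := by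
        rw [iteratedDeriv_riemannXi_one_sub, iteratedDeriv_conj_of_conj riemannXi_conj_holds, hs,
          map_zero, mul_zero]
      exact key _ hzero (by simp; linarith)
    · exact key s hs hgt

/-- `m = 1`, `deriv`-form: **every zero of `ξ′` lies on the critical line iff for every real `t`,
`σ ↦ |ξ′(σ + it)|` is strictly increasing on `[½, ∞)`** (the two-layer equivalence "`Ξ′` has only real
zeros ⟺ horizontal monotone modulus of `ξ′` on the right half of the strip").
[cite: SondowDumitrescu2010, Cor 1 and its proof] [cite: Conrey1983, §1 (p. 49)] -/
theorem deriv_riemannXi_zeros_on_line_iff_norm_deriv_strictMonoOn :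
    (∀ s : ℂ, deriv riemannXi s = 0 → s.re = 1 / 2) ↔
      ∀ t : ℝ, StrictMonoOn (fun σ : ℝ ↦ ‖deriv riemannXi ((σ : ℂ) + t * I)‖) (Ici (1 / 2)) := by
  have h := iteratedDeriv_riemannXi_zeros_on_line_iff_norm_strictMonoOn 1
  simpa only [iteratedDeriv_one] using h

/-! ## Under RH (RH-CONDITIONAL implications) -/

/-- RH-CONDITIONAL. **RH ⇒ for every `m` and real `t`, `σ ↦ |ξ^{(m)}(σ + it)|` is strictly increasing on
`[½, ∞)`** (RH puts the zeros of every `ξ^{(m)}` on the line, Conrey p. 49).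
[cite: SondowDumitrescu2010, Cor 1] [cite: Conrey1983, §1 (p. 49)] -/
theorem riemannHypothesis_imp_norm_iteratedDeriv_riemannXi_strictMonoOn (hRH : RiemannHypothesis)
    (m : ℕ) (t : ℝ) :
    StrictMonoOn (fun σ : ℝ ↦ ‖iteratedDeriv m riemannXi ((σ : ℂ) + t * I)‖) (Ici (1 / 2)) :=
  (iteratedDeriv_riemannXi_zeros_on_line_iff_norm_strictMonoOn m).1
    (fun _ hs ↦ riemannHypothesis_imp_iteratedDeriv_riemannXi_zeros_on_line hRH m hs) t

/-- RH-CONDITIONAL, `m = 1`: RH ⇒ `σ ↦ |ξ′(σ + it)|` is strictly increasing on `[½, ∞)` for every real `t`.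
[cite: SondowDumitrescu2010, Cor 1] [cite: Conrey1983, §1 (p. 49)] -/
theorem riemannHypothesis_imp_norm_deriv_riemannXi_strictMonoOn (hRH : RiemannHypothesis) (t : ℝ) :
    StrictMonoOn (fun σ : ℝ ↦ ‖deriv riemannXi ((σ : ℂ) + t * I)‖) (Ici (1 / 2)) := by
  have h := riemannHypothesis_imp_norm_iteratedDeriv_riemannXi_strictMonoOn hRH 1 t
  simpa only [iteratedDeriv_one] using h

/-! ## Heredity (Jensen's theorem with `Δ = 0`): zeros on the line pass from `ξ^{(m)}` to every `ξ^{(m')}`, `m ≤ m'` -/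

/-- Ξ-form: **if all zeros of `Ξ^{(m)}` are real, then all zeros of every `Ξ^{(m+k)}` are real** (real
zeros stay real under differentiation for real entire functions of order `< 2`: Ki–Kim 2000, Remark 2.2 (b)
with `Δ = 0`, tree `abs_im_le_of_iteratedDeriv_eq_zero`, applied to `Ξ^{(m)}`).
[cite: KiKim2000, §2 p. 50 and Remark 2.2 (b)] -/
theorem iteratedDeriv_riemannXiUpper_zeros_real_of_le {m : ℕ}
    (hm : ∀ z, iteratedDeriv m riemannXiUpper z = 0 → z.im = 0) (k : ℕ) {z : ℂ}
    (hz : iteratedDeriv (m + k) riemannXiUpper z = 0) : z.im = 0 := by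
  obtain ⟨ρ, C, hρ0, hρ, hgr⟩ := exists_growth_riemannXiUpper
  obtain ⟨ρ', C', hρ'0, hρ', hgr'⟩ :=
    exists_growth_iteratedDeriv XiDerivStrip.differentiable_xiUpper hρ0 hρ hgr m
  set f : ℂ → ℂ := iteratedDeriv m riemannXiUpper with hfdef
  have hf : Differentiable ℂ f :=
    differentiable_iteratedDeriv_of_entire XiDerivStrip.differentiable_xiUpper m
  have hreal : ∀ x : ℝ, (f x).im = 0 :=
    im_iteratedDeriv_ofReal XiDerivStrip.differentiable_xiUpper im_riemannXiUpper_ofReal_holds m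
  have hiter : ∀ n, iteratedDeriv n f = iteratedDeriv (m + n) riemannXiUpper := fun n ↦ by
    rw [hfdef, iteratedDeriv_eq_iterate, iteratedDeriv_eq_iterate, iteratedDeriv_eq_iterate,
      ← Function.iterate_add_apply, Nat.add_comm]
  have hnz : ∀ n, iteratedDeriv n f ≠ 0 := fun n ↦ by
    rw [hiter]; exact iteratedDeriv_riemannXiUpper_ne_zero _
  have hstrip : ∀ z, f z = 0 → |z.im| ≤ 0 := fun z hz ↦ by rw [hm z hz, abs_zero]
  have hz' : iteratedDeriv k f z = 0 := by rw [hiter]; exact hz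
  have h := abs_im_le_of_iteratedDeriv_eq_zero hf hρ'0 hρ' hgr' hreal hnz le_rfl hstrip k hz'
  exact abs_nonpos_iff.mp h

/-- **Heredity for `ξ`: if every zero of `ξ^{(m)}` lies on `Re s = ½`, then so does every zero of `ξ^{(m')}`
for all `m' ≥ m`.** (With `m = 0` and RH this is Conrey's remark, p. 49; with `m = 1` it says that
"all zeros of `ξ′` on the line" already puts the zeros of every higher derivative on the line.)
[cite: KiKim2000, Remark 2.2 (b)] [cite: Conrey1983, §1 (p. 49)] -/
theorem iteratedDeriv_riemannXi_zeros_on_line_of_le {m m' : ℕ} (hmm' : m ≤ m')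
    (hm : ∀ s, iteratedDeriv m riemannXi s = 0 → s.re = 1 / 2) {s : ℂ}
    (hs : iteratedDeriv m' riemannXi s = 0) : s.re = 1 / 2 := by
  obtain ⟨k, rfl⟩ := Nat.exists_eq_add_of_le hmm'
  have hmΞ : ∀ z, iteratedDeriv m riemannXiUpper z = 0 → z.im = 0 := fun z hz ↦ by
    have h0 : iteratedDeriv m riemannXi (1 / 2 + I * z) = 0 := by
      have h1 := iteratedDeriv_riemannXiUpper m z
      rw [hz] at h1
      exact (mul_eq_zero.1 h1.symm).resolve_left (pow_ne_zero _ I_ne_zero)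
    have h2 := hm _ h0
    have e : ((1 : ℂ) / 2 + I * z).re = 1 / 2 - z.im := by simp; ring
    rw [e] at h2
    linarith
  set z : ℂ := -I * (s - 1 / 2) with hzdef
  have hsz : 1 / 2 + I * z = s := by
    rw [hzdef]; linear_combination (-(s - 1 / 2)) * I_sq
  have hzero : iteratedDeriv (m + k) riemannXiUpper z = 0 := by
    rw [iteratedDeriv_riemannXiUpper, hsz, hs, mul_zero]
  have him := iteratedDeriv_riemannXiUpper_zeros_real_of_le hmΞ k hzero
  have hzim : z.im = 1 / 2 - s.re := by simp [hzdef]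
  rw [hzim] at him
  linarith

/-- `m = 1`: **if every zero of `ξ′` lies on the critical line, then so does every zero of every `ξ^{(m')}`,
`m' ≥ 1`.** [cite: KiKim2000, Remark 2.2 (b)] [cite: Conrey1983, §1 (p. 49)] -/
theorem iteratedDeriv_riemannXi_zeros_on_line_of_deriv {m' : ℕ} (hm' : 1 ≤ m')
    (h1 : ∀ s, deriv riemannXi s = 0 → s.re = 1 / 2) {s : ℂ}
    (hs : iteratedDeriv m' riemannXi s = 0) : s.re = 1 / 2 :=
  iteratedDeriv_riemannXi_zeros_on_line_of_le hm'
    (fun s hs ↦ h1 s (by simpa only [iteratedDeriv_one] using hs)) hs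

/-- **Heredity of the horizontal monotone modulus**: if for every `t`, `σ ↦ |ξ^{(m)}(σ + it)|` is strictly
increasing on `[½, ∞)`, then the same holds for every `ξ^{(m')}`, `m' ≥ m` (through the Corollary-1
equivalence and the heredity of zeros on the line). [cite: SondowDumitrescu2010, Cor 1] [cite: KiKim2000, Remark 2.2 (b)] -/
theorem norm_iteratedDeriv_riemannXi_strictMonoOn_of_le {m m' : ℕ} (hmm' : m ≤ m')
    (hmono : ∀ t : ℝ, StrictMonoOn (fun σ : ℝ ↦ ‖iteratedDeriv m riemannXi ((σ : ℂ) + t * I)‖)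
      (Ici (1 / 2))) (t : ℝ) :
    StrictMonoOn (fun σ : ℝ ↦ ‖iteratedDeriv m' riemannXi ((σ : ℂ) + t * I)‖) (Ici (1 / 2)) :=
  (iteratedDeriv_riemannXi_zeros_on_line_iff_norm_strictMonoOn m').1
    (fun _ hs ↦ iteratedDeriv_riemannXi_zeros_on_line_of_le hmm'
      ((iteratedDeriv_riemannXi_zeros_on_line_iff_norm_strictMonoOn m).2 hmono) hs) t

/-! ## RH ⟺ the zeros of every `ξ^{(m)}` are on the line ⟺ every `|ξ^{(m)}(σ + it)|` increases on `σ ≥ ½` -/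

/-- **RH ⟺ for every `m`, all zeros of `ξ^{(m)}` lie on `Re s = ½`** ("⇒": Conrey p. 49 for every `m`;
"⇐": the case `m = 0`, Riemann's `Ξ`-formulation of RH, tree
`riemannHypothesis_iff_im_eq_zero_of_riemannXiUpper_eq_zero_holds`). [cite: Conrey1983, §1 (p. 49)] -/
theorem riemannHypothesis_iff_forall_iteratedDeriv_riemannXi_zeros_on_line :
    RiemannHypothesis ↔ ∀ (m : ℕ) (s : ℂ), iteratedDeriv m riemannXi s = 0 → s.re = 1 / 2 := by
  constructor
  · exact fun h m s hs ↦ riemannHypothesis_imp_iteratedDeriv_riemannXi_zeros_on_line h m hs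
  · intro h
    refine riemannHypothesis_iff_im_eq_zero_of_riemannXiUpper_eq_zero_holds.2 fun z hz ↦ ?_
    have h0 : iteratedDeriv 0 riemannXi (1 / 2 + I * z) = 0 := by
      rw [iteratedDeriv_zero]; exact hz
    have hre := h 0 _ h0
    have e : ((1 : ℂ) / 2 + I * z).re = 1 / 2 - z.im := by simp; ring
    rw [e] at hre
    linarith

/-- **RH ⟺ for every `m` and every real `t`, `σ ↦ |ξ^{(m)}(σ + it)|` is strictly increasing on `[½, ∞)`**
(Sondow–Dumitrescu's Corollary 1 for all derivatives at once; `m = 0` alone is already equivalent to RH,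
tree `SondowDumitrescu2010.riemannHypothesis_iff_norm_riemannXi_strictMonoOn`).
[cite: SondowDumitrescu2010, Cor 1] [cite: Conrey1983, §1 (p. 49)] -/
theorem riemannHypothesis_iff_forall_norm_iteratedDeriv_riemannXi_strictMonoOn :
    RiemannHypothesis ↔ ∀ (m : ℕ) (t : ℝ),
      StrictMonoOn (fun σ : ℝ ↦ ‖iteratedDeriv m riemannXi ((σ : ℂ) + t * I)‖) (Ici (1 / 2)) := by
  rw [riemannHypothesis_iff_forall_iteratedDeriv_riemannXi_zeros_on_line]
  exact ⟨fun h m ↦ (iteratedDeriv_riemannXi_zeros_on_line_iff_norm_strictMonoOn m).1 (h m),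
    fun h m ↦ (iteratedDeriv_riemannXi_zeros_on_line_iff_norm_strictMonoOn m).2 (h m)⟩

end Literature.NumberTheory.LFunctions

end
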